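import Summits.BirchSwinnertonDyer.BirchSwinnertonDyer.Theorems.ClassRecordThreeEulerHalvesAtThreeTwistCertificate

/-!
# Route `ClassRecordThree` (rung K2@3), crux 5 `EulerHalvesAtThree` (item 19109): the whole crux from
# the Jetchev direction J₃♭ on surjective frames and a twist SUPPLY TS₃ on ALL of X11b@3 ∧ surj — no
# Skinner Thm. C, no Hoffstein–Luo, no Manin-constant supply among the published inputs
# (cell `bsd-stepL`, seat `bsd-stepL-tam3-p1`, session g4; `--supports stmt-BirchSwinnertonDyer-19109`)

Continuation of `ClassRecordThreeEulerHalvesAtThreeTwistCertificate.lean` (p445872). There §1's per-frame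
consumer `missingUpperBoundAt_three_of_surj_of_jetchevDivisibilityAt_of_twistCertificate` carries NO
(ram)/¬(ram) hypothesis: at a frame with the Tamagawa-level certificate (TC₃ᵗ) the upper half of
`BSD(E,3)` follows from J₃ AT THE FRAME for every `(E,3) ∈` X11b with `ρ̄_{E,3}` onto. In the reduction
of record (p427657/p438720) the (ram) clauses α ∕ γ∖α use Skinner 2016 Thm. C (`hSk`, the twist's
rank-`0` `3`-part at a (ram) curve) and the Hoffstein–Luo field (`hnf`, `hHL`, `hMaz` to produce an
odd Manin-good frame). With a twist supply on ALL surjective X11b@3 curves these published inputs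
drop out of the Euler-system half altogether:

* `classRecordThree_eulerHalvesAtThree_of_jetchevDivisibilityHL_of_twistSupplyAll` — item 19109 BY
  NAME from the published facts {Gross–Zagier, Kolyvagin (rank part), GZK, modularity, Shimura
  reciprocity at conductor `1`, Gross (3.2)/(3.3), McCallum Cor. 5.6 (upper form)} and EXACTLY two
  hypothesis-shaped inputs: **J₃♭** (the Jetchev direction `M_∞ ≥ t` on every Hoffstein–Luo-type frame
  of a surjective X11b@3 curve — the union of the registered J₃ʳ♭ and J₃⁰♭, i.e. g3's `JetchevMaxHL`
  summed over the carriers) and **TS₃ᵃˡˡ** (every surjective X11b@3 curve has SOME odd Manin-good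
  frame with `d_K < −4` whose minimal twist model carries (TC₃ᵗ)). Koly twin.
* Remark (no decl): TS₃ᵃˡˡ is TS₃ (¬(ram), file 1 §2) together with the same supply on (ram) curves;
  the (ram) part is where it competes with Skinner's Thm. C (per pair: one exact modular-symbol value
  versus a printed theorem whose `p = 3` Eisenstein-series input carries the cell's standing caveat
  `SU14-12.3.6-mu@nonsplit@3`, TARGET §1.10 — not adjudicated here).

HONEST FRAMING. Nothing here proves J₃♭ or TS₃ᵃˡˡ; both are hypothesis shapes (no `def`, no named
fact); the item does NOT close; the rung leaf is untouched; CONDITIONAL on every binder; nothing booked;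
no census word moves.

References: [McCallumLMS1991] §5 Cor. 5.6 (p. 310); [Jetchev2008] Conj. 1.3 (p. 812);
[JetchevSkinnerWan2017] §7.4.1–7.4.2 (pp. 30–31); [Skinner2016PacificMC] Thm. C (§1) — the input dropped;
[HoffsteinLuo1997] Theorem (§1) — the input dropped; [Miller2011LMS] Def. 1.1.
-/

noncomputable section

open scoped Classical

namespace Summit.BirchSwinnertonDyer.Rank1Residual.X11b.Three.Koly

open WeierstrassCurve Literature.NumberTheory.EllipticCurves
  Literature.NumberTheory.EllipticCurves.ModularForms
  Literature.NumberTheory.EllipticCurves.Rank1Residual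
  Summit.BirchSwinnertonDyer.Rank1Residual Summit.BirchSwinnertonDyer.Rank1Residual.X11b

/-- **The upper half on ALL of X11b@3 ∧ surj from J₃♭ and a twist supply — no Skinner C, no
Hoffstein–Luo.** `hJ` = **J₃♭**: the Jetchev direction at every Hoffstein–Luo-type Manin-good frame of
a surjective X11b@3 curve (ram or not). `hTS` = **TS₃ᵃˡˡ**: every surjective X11b@3 curve has an odd
Manin-good frame with `d_K < −4` carrying the Tamagawa-level twist certificate (TC₃ᵗ). Then
`Typed.MissingUpperBoundAt W 3` for every such curve, by file 1 §1 at the supplied frame. CONDITIONAL;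
nothing booked. [cite: McCallumLMS1991, §5 Cor. 5.6 (p. 310)] [cite: Jetchev2008, Conj. 1.3 (p. 812)]
[cite: Miller2011LMS, Def. 1.1] -/
theorem missingUpperBoundAt_three_of_classX11b_of_surj_of_jetchevDivisibilityHL_of_twistSupplyAll
    (hGZ : ∀ (N : ℕ) [NeZero N] (W : WeierstrassCurve ℚ) (K : Type) [Field K] [NumberField K],
      gross_zagier N W K)
    (hKo : ∀ (N : ℕ) [NeZero N] (W : WeierstrassCurve ℚ) (K : Type) [Field K] [NumberField K],
      kolyvagin N W K)
    (hGZK : rank_eq_analyticRank_of_analyticRank_le_one) (hmod : hasEntireLFunction_rat)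
    (hrec : ∀ (N : ℕ) [NeZero N] (W : WeierstrassCurve ℚ) (K : Type) [Field K] [NumberField K],
      heegnerPointOfConductor_one_galoisConj N W K)
    (hD36 : ∀ (N : ℕ) [NeZero N] (W : WeierstrassCurve ℚ) (K : Type) [Field K] [NumberField K],
      phi_heegnerTau_mem_singularModuliField N W K)
    (hMcU : McCallum1991_padicValNat_card_sha_primary_add_le_of_globalDivisibility)
    -- OPEN INPUT J₃♭: the Jetchev direction on every HL-type surjective frame (hypothesis shape)
    (hJ : ∀ (W : WeierstrassCurve ℚ) [W.IsElliptic] [W.IsGloballyMinimal] [NeZero (W.conductorNorm ℤ)]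
      (K : Type) [Field K] [NumberField K]
      (Dt : ModularParametrizationData W (W.conductorNorm ℤ)) (β : ℤ) (ι : K →+* ℂ),
      W.analyticRank = 1 → W.HasMultiplicativeReductionAtPrime 3 → Surj W 3 →
      IsImaginaryQuadratic K → SatisfiesHeegnerHypothesis (W.conductorNorm ℤ) K →
      Odd (NumberField.discr K) → (W.quadraticTwist (NumberField.discr K : ℚ)).entireLFunction 1 ≠ 0 →
      (4 * (W.conductorNorm ℤ : ℤ)) ∣ β ^ 2 - NumberField.discr K → ¬ (3 : ℤ) ∣ Dt.c →
      ∀ (s : ℕ), s ≤ padicValNat 3 W.tamagawaProduct →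
        ∀ (n : ℕ) (d : KolyvaginHeegnerData Dt β ι n), Squarefree n →
          (∀ ℓ ∈ n.primeFactors, Zhang2014.IsKolyvaginPrime (W.conductorNorm ℤ) W K 3 ℓ ∧
            s ≤ Zhang2014.kolyvaginIndex W 3 ℓ) → PDiv d 3 s)
    -- OPEN INPUT TS₃ᵃˡˡ: a twist supply with the Tamagawa-level certificate on all of X11b@3 ∧ surj
    (hTS : ∀ (W : WeierstrassCurve ℚ) [W.IsElliptic] [W.IsGloballyMinimal] [NeZero (W.conductorNorm ℤ)],
      ClassX11b W 3 → Surj W 3 →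
      ∃ (K : Type) (_ : Field K) (_ : NumberField K)
        (Dt : ModularParametrizationData W (W.conductorNorm ℤ))
        (H : HeegnerDatum (W.conductorNorm ℤ) (NumberField.discr K)) (ι : K →+* ℂ)
        (P : (W.baseChange K).toAffine.Point)
        (Wd : WeierstrassCurve ℚ) (_ : Wd.IsElliptic) (_ : Wd.IsGloballyMinimal) (Cd : VariableChange ℚ)
        (q : ℚ),
        IsImaginaryQuadratic K ∧ Odd (NumberField.discr K) ∧ NumberField.discr K < -4 ∧
        SatisfiesHeegnerHypothesis (W.conductorNorm ℤ) K ∧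
        WeierstrassCurve.Affine.Point.map ι.toRatAlgHom P = heegnerPointComplex Dt H ∧
        ¬ (3 : ℤ) ∣ Dt.c ∧ Cd • W.quadraticTwist (NumberField.discr K : ℚ) = Wd ∧
        Wd.entireLFunction 1 / (Wd.realPeriodRat : ℂ) = (q : ℂ) ∧ q ≠ 0 ∧
        padicValRat 3 q ≤ (padicValNat 3 Wd.tamagawaProduct : ℤ) - 2 * padicValNat 3 Wd.torsionOrder)
    (W : WeierstrassCurve ℚ) [W.IsElliptic] [W.IsGloballyMinimal]
    (hX : ClassX11b W 3) (hρ : Surj W 3) : Typed.MissingUpperBoundAt W 3 := by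
  haveI : NeZero (W.conductorNorm ℤ) := ⟨(W.conductorNorm_pos_holds).ne'⟩
  obtain ⟨K, _, _, Dt, H, ι, P, Wd, _, _, Cd, q, hK, hodd, hlt, hHN, hP, hc, hWd, hq, hq0, hvq⟩ :=
    hTS W hX hρ
  obtain ⟨hr, h32, hmult, hirr⟩ := hX
  have hD0 : (NumberField.discr K : ℚ) ≠ 0 := by exact_mod_cast NumberField.discr_ne_zero K
  haveI hEt : (W.quadraticTwist (NumberField.discr K : ℚ)).IsElliptic :=
    W.isElliptic_quadraticTwist hD0
  have hLt : (W.quadraticTwist (NumberField.discr K : ℚ)).entireLFunction 1 ≠ 0 := by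
    rw [show (W.quadraticTwist (NumberField.discr K : ℚ)).entireLFunction = Wd.entireLFunction by
      rw [← hWd, entireLFunction_smul]]
    intro h0
    apply hq0
    have : ((q : ℂ)) = 0 := by rw [← hq, h0, zero_div]
    exact_mod_cast this
  exact missingUpperBoundAt_three_of_surj_of_jetchevDivisibilityAt_of_twistCertificate hGZ hKo hGZK hmod
    hrec hD36 hMcU W ⟨hr, h32, hmult, hirr⟩ hρ K hK hodd hlt hHN Dt H ι P hP hc Wd Cd hWd
    ⟨q, hq, hq0, hvq⟩ (hJ W K Dt H.β ι hr hmult hρ hK hHN hodd hLt H.dvd_sq_sub hc)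

/-- **Item 19109 `EulerHalvesAtThree` BY NAME from the published facts and EXACTLY {J₃♭, TS₃ᵃˡˡ}** —
no Skinner Thm. C, no Hoffstein–Luo, no newform/Manin supply. All three clauses are instances of
`missingUpperBoundAt_three_of_classX11b_of_surj_of_jetchevDivisibilityHL_of_twistSupplyAll`; on the
(ram) clauses `Surj W 3` comes from `Irr ∧ Ram` (tree theorem `surj_of_irr_of_ram`: an irreducible
subgroup of `GL₂(𝔽₃)` containing a transvection is everything). CONDITIONAL; the item does NOT close;
nothing booked.
[cite: McCallumLMS1991, §5 Cor. 5.6 (p. 310)] [cite: Jetchev2008, Conj. 1.3 (p. 812)] -/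
theorem classRecordThree_eulerHalvesAtThree_of_jetchevDivisibilityHL_of_twistSupplyAll
    (hGZ : ∀ (N : ℕ) [NeZero N] (W : WeierstrassCurve ℚ) (K : Type) [Field K] [NumberField K],
      gross_zagier N W K)
    (hKo : ∀ (N : ℕ) [NeZero N] (W : WeierstrassCurve ℚ) (K : Type) [Field K] [NumberField K],
      kolyvagin N W K)
    (hGZK : rank_eq_analyticRank_of_analyticRank_le_one) (hmod : hasEntireLFunction_rat)
    (hrec : ∀ (N : ℕ) [NeZero N] (W : WeierstrassCurve ℚ) (K : Type) [Field K] [NumberField K],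
      heegnerPointOfConductor_one_galoisConj N W K)
    (hD36 : ∀ (N : ℕ) [NeZero N] (W : WeierstrassCurve ℚ) (K : Type) [Field K] [NumberField K],
      phi_heegnerTau_mem_singularModuliField N W K)
    (hMcU : McCallum1991_padicValNat_card_sha_primary_add_le_of_globalDivisibility)
    (hJ : ∀ (W : WeierstrassCurve ℚ) [W.IsElliptic] [W.IsGloballyMinimal] [NeZero (W.conductorNorm ℤ)]
      (K : Type) [Field K] [NumberField K]
      (Dt : ModularParametrizationData W (W.conductorNorm ℤ)) (β : ℤ) (ι : K →+* ℂ),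
      W.analyticRank = 1 → W.HasMultiplicativeReductionAtPrime 3 → Surj W 3 →
      IsImaginaryQuadratic K → SatisfiesHeegnerHypothesis (W.conductorNorm ℤ) K →
      Odd (NumberField.discr K) → (W.quadraticTwist (NumberField.discr K : ℚ)).entireLFunction 1 ≠ 0 →
      (4 * (W.conductorNorm ℤ : ℤ)) ∣ β ^ 2 - NumberField.discr K → ¬ (3 : ℤ) ∣ Dt.c →
      ∀ (s : ℕ), s ≤ padicValNat 3 W.tamagawaProduct →
        ∀ (n : ℕ) (d : KolyvaginHeegnerData Dt β ι n), Squarefree n →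
          (∀ ℓ ∈ n.primeFactors, Zhang2014.IsKolyvaginPrime (W.conductorNorm ℤ) W K 3 ℓ ∧
            s ≤ Zhang2014.kolyvaginIndex W 3 ℓ) → PDiv d 3 s)
    (hTS : ∀ (W : WeierstrassCurve ℚ) [W.IsElliptic] [W.IsGloballyMinimal] [NeZero (W.conductorNorm ℤ)],
      ClassX11b W 3 → Surj W 3 →
      ∃ (K : Type) (_ : Field K) (_ : NumberField K)
        (Dt : ModularParametrizationData W (W.conductorNorm ℤ))
        (H : HeegnerDatum (W.conductorNorm ℤ) (NumberField.discr K)) (ι : K →+* ℂ)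
        (P : (W.baseChange K).toAffine.Point)
        (Wd : WeierstrassCurve ℚ) (_ : Wd.IsElliptic) (_ : Wd.IsGloballyMinimal) (Cd : VariableChange ℚ)
        (q : ℚ),
        IsImaginaryQuadratic K ∧ Odd (NumberField.discr K) ∧ NumberField.discr K < -4 ∧
        SatisfiesHeegnerHypothesis (W.conductorNorm ℤ) K ∧
        WeierstrassCurve.Affine.Point.map ι.toRatAlgHom P = heegnerPointComplex Dt H ∧
        ¬ (3 : ℤ) ∣ Dt.c ∧ Cd • W.quadraticTwist (NumberField.discr K : ℚ) = Wd ∧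
        Wd.entireLFunction 1 / (Wd.realPeriodRat : ℂ) = (q : ℂ) ∧ q ≠ 0 ∧
        padicValRat 3 q ≤ (padicValNat 3 Wd.tamagawaProduct : ℤ) - 2 * padicValNat 3 Wd.torsionOrder) :
    Summit.BirchSwinnertonDyer.BirchSwinnertonDyer.Theses.ClassRecordThree.EulerHalvesAtThree := by
  unfold Summit.BirchSwinnertonDyer.BirchSwinnertonDyer.Theses.ClassRecordThree.EulerHalvesAtThree
  intro W _ _ hX
  have key : Surj W 3 → Typed.MissingUpperBoundAt W 3 := fun hρ ↦
    missingUpperBoundAt_three_of_classX11b_of_surj_of_jetchevDivisibilityHL_of_twistSupplyAll hGZ hKo hGZK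
      hmod hrec hD36 hMcU hJ hTS W hX hρ
  refine ⟨fun hram _ ↦ key ?_, fun hram _ _ _ ↦ key ?_, fun hρ _ ↦ key hρ⟩
  · exact surj_of_irr_of_ram W 3 hX.2.2.2 hram
  · exact surj_of_irr_of_ram W 3 hX.2.2.2 hram

/-- **The shared decl of route `KolyvaginRoadThree` (same statement) from {J₃♭, TS₃ᵃˡˡ}.** [folklore] -/
theorem kolyvaginRoadThree_eulerHalvesAtThree_of_jetchevDivisibilityHL_of_twistSupplyAll
    (hGZ : ∀ (N : ℕ) [NeZero N] (W : WeierstrassCurve ℚ) (K : Type) [Field K] [NumberField K],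
      gross_zagier N W K)
    (hKo : ∀ (N : ℕ) [NeZero N] (W : WeierstrassCurve ℚ) (K : Type) [Field K] [NumberField K],
      kolyvagin N W K)
    (hGZK : rank_eq_analyticRank_of_analyticRank_le_one) (hmod : hasEntireLFunction_rat)
    (hrec : ∀ (N : ℕ) [NeZero N] (W : WeierstrassCurve ℚ) (K : Type) [Field K] [NumberField K],
      heegnerPointOfConductor_one_galoisConj N W K)
    (hD36 : ∀ (N : ℕ) [NeZero N] (W : WeierstrassCurve ℚ) (K : Type) [Field K] [NumberField K],
      phi_heegnerTau_mem_singularModuliField N W K)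
    (hMcU : McCallum1991_padicValNat_card_sha_primary_add_le_of_globalDivisibility)
    (hJ : ∀ (W : WeierstrassCurve ℚ) [W.IsElliptic] [W.IsGloballyMinimal] [NeZero (W.conductorNorm ℤ)]
      (K : Type) [Field K] [NumberField K]
      (Dt : ModularParametrizationData W (W.conductorNorm ℤ)) (β : ℤ) (ι : K →+* ℂ),
      W.analyticRank = 1 → W.HasMultiplicativeReductionAtPrime 3 → Surj W 3 →
      IsImaginaryQuadratic K → SatisfiesHeegnerHypothesis (W.conductorNorm ℤ) K →
      Odd (NumberField.discr K) → (W.quadraticTwist (NumberField.discr K : ℚ)).entireLFunction 1 ≠ 0 →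
      (4 * (W.conductorNorm ℤ : ℤ)) ∣ β ^ 2 - NumberField.discr K → ¬ (3 : ℤ) ∣ Dt.c →
      ∀ (s : ℕ), s ≤ padicValNat 3 W.tamagawaProduct →
        ∀ (n : ℕ) (d : KolyvaginHeegnerData Dt β ι n), Squarefree n →
          (∀ ℓ ∈ n.primeFactors, Zhang2014.IsKolyvaginPrime (W.conductorNorm ℤ) W K 3 ℓ ∧
            s ≤ Zhang2014.kolyvaginIndex W 3 ℓ) → PDiv d 3 s)
    (hTS : ∀ (W : WeierstrassCurve ℚ) [W.IsElliptic] [W.IsGloballyMinimal] [NeZero (W.conductorNorm ℤ)],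
      ClassX11b W 3 → Surj W 3 →
      ∃ (K : Type) (_ : Field K) (_ : NumberField K)
        (Dt : ModularParametrizationData W (W.conductorNorm ℤ))
        (H : HeegnerDatum (W.conductorNorm ℤ) (NumberField.discr K)) (ι : K →+* ℂ)
        (P : (W.baseChange K).toAffine.Point)
        (Wd : WeierstrassCurve ℚ) (_ : Wd.IsElliptic) (_ : Wd.IsGloballyMinimal) (Cd : VariableChange ℚ)
        (q : ℚ),
        IsImaginaryQuadratic K ∧ Odd (NumberField.discr K) ∧ NumberField.discr K < -4 ∧
        SatisfiesHeegnerHypothesis (W.conductorNorm ℤ) K ∧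
        WeierstrassCurve.Affine.Point.map ι.toRatAlgHom P = heegnerPointComplex Dt H ∧
        ¬ (3 : ℤ) ∣ Dt.c ∧ Cd • W.quadraticTwist (NumberField.discr K : ℚ) = Wd ∧
        Wd.entireLFunction 1 / (Wd.realPeriodRat : ℂ) = (q : ℂ) ∧ q ≠ 0 ∧
        padicValRat 3 q ≤ (padicValNat 3 Wd.tamagawaProduct : ℤ) - 2 * padicValNat 3 Wd.torsionOrder) :
    Summit.BirchSwinnertonDyer.BirchSwinnertonDyer.Theses.KolyvaginRoadThree.EulerHalvesAtThree :=
  classRecordThree_eulerHalvesAtThree_of_jetchevDivisibilityHL_of_twistSupplyAll hGZ hKo hGZK hmod hrec hD36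
    hMcU hJ hTS

/-! ### Strength bookkeeping: TL₃ is a consequence of BSD₃ for rank-zero curves; TS₃ is not claimed so -/

/-- **TL₃ ⟸ `BSD(V,3)` for the rank-zero curves it quantifies over** (strength bookkeeping for the
planner's choice between the two class-wide suppliers of clause (0)): if Miller's `BSDp V 3` holds for
every `V/ℚ` multiplicative at `3` with `V[3]` irreducible and `L(V,1) ≠ 0`, then TL₃ holds — with
EQUALITY, by the tree's `pPart_of_bsdp` (rank `≤ 1` print shape) read in rank `0` (`Reg = 1`,
`L^{(0)}(V,1) = L(V,1)`). So TL₃ is no stronger than BSD₃ on its own locus (as J₃ is, p429303); the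
twist SUPPLY TS₃ is a horizontal statement («some twist has `Ш[3] = 0`») NOT implied by BSD — the
price of its per-pair certifiability. Bookkeeping only; nothing asserted. [cite: Miller2011LMS, Def. 1.1]
[cite: Skinner2016PacificMC, Thm. C (§1) — shape] -/
theorem twistLowerAtThree_of_forall_bsdp (hmod : hasEntireLFunction_rat)
    (hGZK : rank_eq_analyticRank_of_analyticRank_le_one)
    (hBSD : ∀ (V : WeierstrassCurve ℚ) [V.IsElliptic] [V.IsGloballyMinimal],
      V.HasMultiplicativeReductionAtPrime 3 → V.HasIrreducibleModPGaloisRep 3 →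
      V.entireLFunction 1 ≠ 0 → BSDp V 3) :
    ∀ (V : WeierstrassCurve ℚ) [V.IsElliptic] [V.IsGloballyMinimal],
      V.HasMultiplicativeReductionAtPrime 3 → V.HasIrreducibleModPGaloisRep 3 →
      V.entireLFunction 1 ≠ 0 → Finite V.sha →
      ∃ q : ℚ, V.entireLFunction 1 / (V.realPeriodRat : ℂ) = (q : ℂ) ∧
        padicValRat 3 q ≤ (padicValNat 3 V.shaOrder : ℤ) + padicValNat 3 V.tamagawaProduct -
          2 * padicValNat 3 V.torsionOrder := by
  intro V _ _ hmult hirr hL _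
  haveI : Fact (Nat.Prime 3) := ⟨Nat.prime_three⟩
  have hr : V.analyticRank = 0 := (V.analyticRank_eq_zero_iff_holds (hmod V)).2 hL
  have hrank : V.mordellWeilRank = 0 := by
    have := (hGZK V (by omega)).1
    omega
  obtain ⟨q, hq, hv⟩ := pPart_of_bsdp hmod hGZK V 3 (by omega) (hBSD V hmult hirr hL)
  refine ⟨q, ?_, hv.le⟩
  rw [V.regulator_eq_one_of_rank_zero hrank, mul_one, leadingLCoeff_eq_of_analyticRank_eq_zero V hr]
    at hq
  exact hq

end Summit.BirchSwinnertonDyer.Rank1Residual.X11b.Three.Koly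

end
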